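import Literature.AnabelianGeometry.EtaleTheta.Discharge.Sec2Cor28iBindersOfSection
import Literature.AnabelianGeometry.EtaleTheta.Discharge.Sec2OuterPC5Reduction
import Literature.AnabelianGeometry.EtaleTheta.Discharge.Sec2HuuOfSectionParamMemPiCu
import Literature.AnabelianGeometry.EtaleTheta.Discharge.Sec2HuuNormalizerModelChi
import Literature.AnabelianGeometry.EtaleTheta.Discharge.Sec2OuterEtaChiModel
import Literature.AnabelianGeometry.EtaleTheta.Discharge.Sec1EtaChiEpsMuFixes
import Literature.AnabelianGeometry.EtaleTheta.Discharge.Sec1Prop18ConjEpsPMModelChi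
import Literature.AnabelianGeometry.EtaleTheta.Discharge.Sec2DtauInversionStable
import Literature.AnabelianGeometry.EtaleTheta.SettingModelChiThetaDoubleUnderline
import Literature.AnabelianGeometry.EtaleTheta.SettingModelChiDoubleUnderlineCensus
import HarnessLib

/-!
# [EtTh] Cor 2.8 (iii), OUTER clauses 3–4: the END-KNIT at the cusped inversion model `χ′` — for EVERY
# conjugator, modulo Cor 2.8 (iii)'s OWN binders only (P-C5 and its dotted junction DISCHARGED; proof-only)

S. Mochizuki, *The étale theta function and its Frobenioid-theoretic manifestations* [EtTh], Publ. RIMS **45**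
(2009), §2, Cor 2.8 (iii), PRIMS PDF p.42 («if `γ` arises from an inner automorphism of `Π^tp_{Ċ̲̲}` (resp.
`Π^tp_{Ċ̲}`), then `γ` preserves `η̲̈^{Θ,l·ℤ}` (resp. `η̈^{Θ,l·ℤ}`)»; proof: «follows immediately from Remark 1.9.1»),
Rmk 1.9.1 p.29, Def 1.7 p.27 (`Π^tp_Ẋ`, `Π^tp_Ċ`, `ε_μ`, `ε_±`, `ε_Z`), Def 2.3 p.38, Def 2.5 (i)(ii) p.39
(bib key `MochizukiEtTh2009`).

PROOF-ONLY companion (0 `def`, 0 `instance`, no new `Prop`; cell abc-iut, layer L2, seat abc-iut-w6-d050 gen 5,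
row «COR28iii-OUTER-ENDKNIT@χ′» of abc-iut-L2-lead R595/R620; recipe of abc-iut-w6-d049 (STATUS 19:22:32Z) with the
input census of abc-iut-w5-d123 (19:41:02Z); every input BY NAME).  The OUTER chain for node EtTh:Cor2.8(iii)
(abc-iut-w6-d051 `ofEmbedding_cor28_iii_outer_reduced` p437630 → abc-iut-w6-d049 `cor28_iii_outer_orbitEmbeddingOfHuuOfSection`
p453395) proves clauses 3–4 of `ThetaOrbitData.Cor28_iii` at `ofEmbedding ε hC hS` for every conjugator `y ∈ Π^tp_C`
modulo Cor 2.8 (iii)'s own binders (`Γ_Θ`+`InducesOnTheta`, `hY`, `hYuu`) AND the binder **P-C5**: an element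
`σ₀ ∈ Π^tp_{Ẋ̲̲}` (`ε.dotXuu`) with `autMap α_y⁻¹ β_y⁻¹ η̈^Θ = conj σ₀ η̈^Θ`.  THIS FILE discharges P-C5 at the χ′ site —
`M := MuTwoSetting.inversionModelχ′ p` (abc-iut-w5-d140), abc-iut-L2-d3's SECTION-route cover
`e.temperedCoverDataOfHuuOfSection … (g := ε_±)` / `orbitEmbeddingOfHuuOfSection` (p452017; instance arguments as in
abc-iut-L2-t10's `nonempty_orbitEmbedding_inversionModelχ′`), any étale-theta datum `E` over `modelχ′` carrying the
model class `η̈^Θ = etaDdχ` (abc-iut-L2-d1), any `X̲̲` with `Π^tp_{X̲̲} = Huuχ p l`: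
* §1 `conj_etaDdχ_eq_self_of_mem_GtpY` — ALL of `Π^tp_Y` stabilises `etaDdχ` (`Π^tp_Ÿ` by inner automorphisms,
  abc-iut-L2-t1's `ContH1.conj_eq_self_of_mem`; the other `Π^tp_Ÿ`-coset is `Π^tp_Ÿ·b` by `[Π^tp_Y : Π^tp_Ÿ] = 2`
  (abc-iut-L2-t8's `relIndex_GtpYdd_GtpY`) and `b = ε_μ` FIXES the class, abc-iut-w6-d049's `conj_inl_b_etaDdχ` p460521);
  `b ∈ Π^tp_{X̲̲}` is abc-iut-L2-d1's `inl_gfpOf_of_one_mem_Huuχ`; `twistedInversion_mem_GtpXu_modelχ'` (`ι` preserves `Π^tp_{X̲}`);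
* §2 (generic Def 1.7 bookkeeping over any `MuTwoSetting`) `epsMu_not_mem_dotC` (`ε_μ ∉ Π^tp_Ċ`) and
  `mul_epsMu_mem_dotC_of_not_mem` (`g ∉ Π^tp_Ċ ⇒ g·ε_μ ∈ Π^tp_Ċ`, index `2`);
* §3 **`exists_mem_dotXuu_pC5_inversionModelχ'`** — THE JUNCTION: for every `y ∈ Π^tp_{C̲}` (`T.tp T.PiCu`) there is
  `σ ∈ Π^tp_{Ẋ̲̲}` (`ε.dotXuu`) with `autMap α_y⁻¹ β_y⁻¹ η̈^Θ = conj σ η̈^Θ` in the exact `hη`-shape of p453395.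
  Construction: abc-iut-w6-d083's model P-C5 `exists_autMap_symm_etaDdχ_eq_conj` (p443069) gives
  `σ₀ = (φ_{y₂} y₁)⁻¹`; `σ₀ ∈ Π^tp_{X̲}` because `inclX y₁ = y·(inr y₂)⁻¹ ∈ Π^tp_{C̲}` — abc-iut-L2-d3's export
  `temperedCoverDataOfHuuOfSection_mem_tp_PiCu` (p462942, «`ε_± ∈ Π^tp_{C̲}`») with its binder `hNX` supplied by
  abc-iut-w6-d049's `normalizer_Huuχ_le_GtpXu_modelχ'` (p463236), then `mem_GtpXu_of_ι_mem_tp_PiCu` (p455742) and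
  `ι`-stability; `Π^tp_{X̲} = Π^tp_{X̲̲}·Π^tp_Y` (abc-iut-L2-t8's field `map_toZ_Huu`) and §1 move `σ₀` into `Π^tp_{X̲̲}`
  without changing `conj_{σ₀} η̈^Θ`; the `Ċ`-parity is fixed by `b ∈ Π^tp_{X̲̲}` (§1, §2: `inclX b = ε_μ ∉ Π^tp_Ċ` of index 2);
* §4 **`cor28_iii_outer_endKnit_inversionModelχ'`** — conjuncts 3–4 of `ThetaOrbitData.Cor28_iii` at
  `ofEmbedding (orbitEmbeddingOfHuuOfSection …) _ _` over `inversionModelχ′` for EVERY conjugator `y ∈ Π^tp_C`, modulo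
  Cor 2.8 (iii)'s OWN binders (`Γ_Θ`+`InducesOnTheta`, `hY`, `hYuu`) ONLY (`hq`, `Compat`, `Sec2Hyps` are theorems at χ′:
  `isQuotientMap_toTheta_inversionModelχ'` p451471, `inversionModelχ'_compat`, `modelχ'_sec2Hyps`).
HONEST FRAMING: semi-synthetic model (χ-twisted root with one synthetic cusp; the theta class OF THE MODEL) =
consistency / non-vacuity evidence for the typed interface only; the constructor's own binders (`op`, `s`/`hsa`/`hsZ`/`hsH`,
`hιell`, `hN`, `hY`, `hK`, `IotaStable`, `τ^{±1}`) stay in hypothesis position exactly as in p453395; [EtTh] is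
refereed and nothing of it is asserted; no side is taken on [IUTchIII] Cor 3.12; typed ≠ proved; instantiated ≠ endorsed.
-/

noncomputable section

namespace Literature.AnabelianGeometry.EtaleTheta

open Literature.AnabelianGeometry.SemiGraphs ThetaCovers Literature.IUT.HodgeArakelov
open _root_.Topology _root_.Function
open ThetaSetting.EtaleThetaData.DoubleUnderline.OrbitEmbedding (symm_toTheta_eq)

universe u

/-! ## §0. `Π^tp_{C̲̲} ≤ Π^tp_{C̲}` in any tempered cover -/

namespace ThetaCovers.TemperedCoverData

/-- `Π^tp_{C̲̲} ≤ Π^tp_{C̲}` (`Π_{C̲} = Π_{C̲̲}·Δ̄_Θ`, Def 2.1/2.3; pulled back to `Π^tp_C`). [cite: MochizukiEtTh2009, Def 2.3 p.38] -/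
theorem tp_PiCuu_le_tp_PiCu {l : ℕ} (T : TemperedCoverData.{u} l) : T.tp T.PiCuu ≤ T.tp T.PiCu :=
  Subgroup.comap_mono le_sup_left

end ThetaCovers.TemperedCoverData

/-! ## §2. Def 1.7 bookkeeping: `ε_μ ∉ Π^tp_Ċ`; the `Ċ`-parity of a product with `ε_μ` -/

namespace MuTwoSetting

variable {p : ℕ} [Fact p.Prime] (M : MuTwoSetting p)

/-- **`ε_μ ∉ Π^tp_Ċ`** for an admissible `ε_Z`: `Π^tp_Ċ ∩ Π^tp_X = Π^tp_Ẋ` (abc-iut-L6-t1's `dotC_inf_range`) and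
`ε_μ ∉ Π^tp_Ẋ` (abc-iut-w6-d049's `epsMu_not_mem_dotX`). [cite: MochizukiEtTh2009, Def 1.7 p.27] -/
theorem epsMu_not_mem_dotC {εZ : M.GtpC} (hZ : M.IsAdmissibleEpsZ εZ) : M.epsMu ∉ M.dotC εZ := fun h =>
  M.epsMu_not_mem_dotX hZ (by
    have h' : M.epsMu ∈ M.dotC εZ ⊓ M.inclX.range := Subgroup.mem_inf.2 ⟨h, M.epsMu_mem⟩
    rwa [M.dotC_inf_range hZ] at h')

/-- **Parity correction by `ε_μ`**: `[Π^tp_C : Π^tp_Ċ] = 2` (abc-iut-L6-t1's `index_dotC`), so an element outside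
`Π^tp_Ċ` times `ε_μ ∉ Π^tp_Ċ` lies in `Π^tp_Ċ`. [cite: MochizukiEtTh2009, Def 1.7 p.27] -/
theorem mul_epsMu_mem_dotC_of_not_mem {εZ : M.GtpC} (hZ : M.IsAdmissibleEpsZ εZ) {g : M.GtpC}
    (hg : g ∉ M.dotC εZ) : g * M.epsMu ∈ M.dotC εZ :=
  (Subgroup.mul_mem_iff_of_index_two (M.index_dotC hZ)).2 (iff_of_false hg (M.epsMu_not_mem_dotC hZ))

end MuTwoSetting

namespace SettingModel

variable (p : ℕ) [Fact p.Prime]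

/-! ## §1. At the χ-model: `Π^tp_Y` stabilises `η̈^Θ = etaDdχ`; `ι` preserves `Π^tp_{X̲}` -/

/-- **All of `Π^tp_Y` stabilises the model class `η̈^Θ = etaDdχ`**: `Π^tp_Ÿ` acts trivially on
`H¹(Π^tp_Ÿ, Δ_Θ)` (inner automorphisms), `[Π^tp_Y : Π^tp_Ÿ] = 2` with the non-trivial coset represented by
`b = ε_μ ∉ Π^tp_Ẍ ⊇ Π^tp_Ÿ`, and `conj_b η̈^Θ = η̈^Θ` (abc-iut-w6-d049's `conj_inl_b_etaDdχ`; print's `ε_μ ↦ −η̈^{Θ,ℤ}`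
is not reproduced by the semi-synthetic class — a label on OUR model). [cite: MochizukiEtTh2009, Rmk 1.9.1 p.29] -/
theorem conj_etaDdχ_eq_self_of_mem_GtpY {y : PiTpχ p} (hy : y ∈ (ThetaSetting.modelχ p).GtpY) :
    haveI := (ThetaSetting.modelχ p).compat.GtpYdd_normal
    ContH1.conj (ThetaSetting.modelχ p).toTheta (ThetaSetting.modelχ p).DeltaTheta y (etaDdχ p) = etaDdχ p := by
  haveI := (ThetaSetting.modelχ p).compat.GtpYdd_normal
  by_cases hydd : y ∈ (ThetaSetting.modelχ p).GtpYdd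
  · exact ContH1.conj_eq_self_of_mem y hydd _
  · have hbY : (SemidirectProduct.inl (gfpOf (FreeGroup.of 1)) : PiTpχ p) ∈ (ThetaSetting.modelχ p).GtpY :=
      toZ_inl_gfpOf_one p
    have hbdd : (SemidirectProduct.inl (gfpOf (FreeGroup.of 1)) : PiTpχ p) ∉ (ThetaSetting.modelχ p).GtpYdd :=
      fun h => inl_gfpOf_one_not_mem_Xddχ p (gtpYdd_modelχ_le_Xddχ p h)
    have hidx : ((ThetaSetting.modelχ p).GtpYdd.subgroupOf (ThetaSetting.modelχ p).GtpY).index = 2 :=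
      ThetaSetting.relIndex_GtpYdd_GtpY (ThetaSetting.modelχ_sec2Hyps p)
    have hmem : y * (SemidirectProduct.inl (gfpOf (FreeGroup.of 1)) : PiTpχ p)⁻¹ ∈
        (ThetaSetting.modelχ p).GtpYdd := by
      have h := (Subgroup.mul_mem_iff_of_index_two hidx (a := (⟨y, hy⟩ : (ThetaSetting.modelχ p).GtpY))
        (b := (⟨_, hbY⟩ : (ThetaSetting.modelχ p).GtpY)⁻¹)).2
        (iff_of_false (by rwa [Subgroup.mem_subgroupOf])
          (by rwa [Subgroup.mem_subgroupOf, Subgroup.coe_inv, inv_mem_iff]))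
      rwa [Subgroup.mem_subgroupOf, Subgroup.coe_mul, Subgroup.coe_inv] at h
    calc ContH1.conj (ThetaSetting.modelχ p).toTheta (ThetaSetting.modelχ p).DeltaTheta y (etaDdχ p)
        = ContH1.conj (ThetaSetting.modelχ p).toTheta (ThetaSetting.modelχ p).DeltaTheta
            (y * (SemidirectProduct.inl (gfpOf (FreeGroup.of 1)) : PiTpχ p)⁻¹ *
              (SemidirectProduct.inl (gfpOf (FreeGroup.of 1)) : PiTpχ p)) (etaDdχ p) := by
          rw [inv_mul_cancel_right]
      _ = etaDdχ p := by
          rw [ContH1.conj_mul_apply, conj_inl_b_etaDdχ p]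
          exact ContH1.conj_eq_self_of_mem _ hmem _

/-- **`ι` preserves `Π^tp_{X̲} = toZ⁻¹(l·Z)`** at the cusped χ-model (`toZ ∘ ι = toZ⁻¹`, abc-iut-L2-t10's
`toZ_twistedInversion_modelχ`; same `toZ` at `modelχ′`). [cite: MochizukiEtTh2009, Prop 2.4 p.38] -/
theorem twistedInversion_mem_GtpXu_modelχ' {l : ℕ} {g : PiTpχ p} (hg : g ∈ (ThetaSetting.modelχ' p).GtpXu l) :
    twistedInversion (chi p) g ∈ (ThetaSetting.modelχ' p).GtpXu l := by
  have h : (ThetaSetting.modelχ' p).toZ (twistedInversion (chi p) g) = ((ThetaSetting.modelχ' p).toZ g)⁻¹ :=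
    toZ_twistedInversion_modelχ p g
  change (ThetaSetting.modelχ' p).toZ (twistedInversion (chi p) g) ∈ ThetaSetting.lZ l
  rw [h]
  exact Subgroup.inv_mem _ hg

/-! ## §3. The JUNCTION at χ′: P-C5 with a witness in `Π^tp_{Ẋ̲̲}` for every `y ∈ Π^tp_{C̲}` -/

section EndKnit

variable {PC : Type} [Group PC] [TopologicalSpace PC] [IsTopologicalGroup PC] [T2Space PC]
variable (e : (MuTwoSetting.inversionModelχ' p).CLevelData)
  (ιC : (MuTwoSetting.inversionModelχ' p).GtpC →ₜ* PC) (hιC : IsProfiniteCompletion ιC)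
  (hinj : Function.Injective ιC) (op : (MuTwoSetting.inversionModelχ' p).toThetaSetting.OncePuncturedData)
  {l : ℕ+} (hodd : Odd ((l : ℕ+) : ℕ))
  (s : ↥(MuTwoSetting.inversionModelχ' p).GK →* (MuTwoSetting.inversionModelχ' p).PiTemp)
  (hsa : ∀ σ, (MuTwoSetting.inversionModelχ' p).aug (s σ) = (σ : GQp p))
  (hsZ : ∀ σ, (MuTwoSetting.inversionModelχ' p).toZ (s σ) = 1)
  (hιell : ∀ c ∈ (e.piCDataOf ιC hιC).augGK.ker, c ∉ (e.piCDataOf ιC hιC).PiX →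
    ∀ d ∈ (e.piCDataOf ιC hιC).PiX ⊓ (e.piCDataOf ιC hιC).augGK.ker,
      c * d * c⁻¹ * d ∈ (e.piCDataOf ιC hιC).barTheta l)
  (hN : (((MuTwoSetting.inversionModelχ' p).GtpXu l).map (MuTwoSetting.inversionModelχ' p).inclX).Normal)
  (hY : ((MuTwoSetting.inversionModelχ' p).GtpY.map (MuTwoSetting.inversionModelχ' p).inclX).Normal)
  {E : (MuTwoSetting.inversionModelχ' p).toThetaSetting.EtaleThetaData} (hE : E.etaDd = etaDdχ p)
  (C : E.DoubleUnderline (l : ℕ)) (hC : C.Huu = Huuχ p l)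
  (hK : (MuTwoSetting.inversionModelχ' p).barKerTp l ≤ C.Huu) (hsH : ∀ σ, s σ ∈ C.Huu)
  (hι : C.IotaStable (e.conjX (epsPMInvχ p)))
  (τ τ' : ThetaSetting.NonCuspidalPoint E.toKummerData)

include hE hC

/-- **THE JUNCTION (P-C5 with its dotted witness) at χ′.**  For every `y ∈ Π^tp_{C̲}` of abc-iut-L2-d3's SECTION-route
cover (`g := ε_±`), there is `σ ∈ Π^tp_{Ẋ̲̲}` (`ε.dotXuu`) such that, for the pair `(e.conjX y, topCompanion …)` and ANY
membership proofs, `autMap α⁻¹ β⁻¹ η̈^Θ = conj σ η̈^Θ` — the binder `hη`/`hσ₀` of `cor28_iii_outer_orbitEmbeddingOfHuuOfSection`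
(p453395) DISCHARGED for the model class `η̈^Θ = etaDdχ`: model P-C5 (abc-iut-w6-d083, p443069) gives `σ₀ = (φ_{y₂} y₁)⁻¹ ∈ Π^tp_{X̲}`
(«`ε_± ∈ Π^tp_{C̲}`» p462942 + `hNX` p463236), moved into `Π^tp_{X̲̲}` along `Π^tp_{X̲} = Π^tp_{X̲̲}·Π^tp_Y` (stabiliser §1) and
into `Π^tp_Ċ` by the stabilising `b = ε_μ ∉ Π^tp_Ċ`. [cite: MochizukiEtTh2009, Cor 2.8(iii) p.42] -/
theorem exists_mem_dotXuu_pC5_inversionModelχ'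
    (y : (e.temperedCoverDataOfHuuOfSection ιC hιC hinj op hodd s hsa hsZ hιell hN hY C hK hsH
      (epsPMInvχ_not_mem_range p) hι).Gtp)
    (hy : y ∈ (e.temperedCoverDataOfHuuOfSection ιC hιC hinj op hodd s hsa hsZ hιell hN hY C hK hsH
        (epsPMInvχ_not_mem_range p) hι).tp
      (e.temperedCoverDataOfHuuOfSection ιC hιC hinj op hodd s hsa hsZ hιell hN hY C hK hsH
        (epsPMInvχ_not_mem_range p) hι).PiCu) :
    ∃ σ ∈ (e.orbitEmbeddingOfHuuOfSection ιC hιC hinj op hodd s hsa hsZ hιell hN hY C hK hsH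
        (epsPMInvχ_not_mem_range p) hι τ τ').dotXuu,
      ∀ (hΔ' : ∀ a, a ∈ (MuTwoSetting.inversionModelχ' p).toThetaSetting.DeltaTheta →
          (Thm16Sub.topCompanion (MuTwoSetting.inversionModelχ' p).toThetaSetting
            (MuTwoSetting.inversionModelχ' p).toThetaSetting (e.conjX y) (e.map_deltaTemp_conjX y)
            (isQuotientMap_toTheta_inversionModelχ' p) (isQuotientMap_toTheta_inversionModelχ' p)).symm a ∈
            (MuTwoSetting.inversionModelχ' p).toThetaSetting.DeltaTheta)
        (hYα : ∀ g, g ∈ (MuTwoSetting.inversionModelχ' p).toThetaSetting.GtpYdd →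
          e.conjX y g ∈ (MuTwoSetting.inversionModelχ' p).toThetaSetting.GtpYdd),
      haveI := (MuTwoSetting.inversionModelχ'_compat p).GtpYdd_normal
      ContH1Aut.autMap (MuTwoSetting.inversionModelχ' p).toTheta
          (MuTwoSetting.inversionModelχ' p).toThetaSetting.DeltaTheta (e.conjX y).symm
          (Thm16Sub.topCompanion (MuTwoSetting.inversionModelχ' p).toThetaSetting
            (MuTwoSetting.inversionModelχ' p).toThetaSetting (e.conjX y) (e.map_deltaTemp_conjX y)
            (isQuotientMap_toTheta_inversionModelχ' p) (isQuotientMap_toTheta_inversionModelχ' p)).symm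
          (symm_toTheta_eq (e.orbitEmbeddingOfHuu_topCompanion_toTheta (isQuotientMap_toTheta_inversionModelχ' p) y))
          hΔ' (H := (MuTwoSetting.inversionModelχ' p).toThetaSetting.GtpYdd)
          (H' := (MuTwoSetting.inversionModelχ' p).toThetaSetting.GtpYdd) hYα E.etaDd =
        ContH1.conj (MuTwoSetting.inversionModelχ' p).toTheta
          (MuTwoSetting.inversionModelχ' p).toThetaSetting.DeltaTheta σ E.etaDd := by
  haveI hNχ := (ThetaSetting.modelχ p).compat.GtpYdd_normal
  -- the admissible `ε_Z` behind `Π^tp_Ċ = T.PiCdot`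
  have hZ := Classical.choose_spec (MuTwoSetting.inversionModelχ' p).exists_isAdmissibleEpsZ
  have hPiCdot : (e.temperedCoverDataOfHuuOfSection ιC hιC hinj op hodd s hsa hsZ hιell hN hY C hK hsH
      (epsPMInvχ_not_mem_range p) hι).PiCdot = (MuTwoSetting.inversionModelχ' p).dotC
      (Classical.choose (MuTwoSetting.inversionModelχ' p).exists_isAdmissibleEpsZ) := rfl
  -- «`ε_± ∈ Π^tp_{C̲}`» (abc-iut-L2-d3's export, `hNX` by abc-iut-w6-d049's normaliser theorem)
  have hεpm := e.temperedCoverDataOfHuuOfSection_mem_tp_PiCu ιC hιC hinj op hodd s hsa hsZ hιell hN hY C hK hsH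
      (epsPMInvχ_not_mem_range p) hι (by rw [hC]; exact normalizer_Huuχ_le_GtpXu_modelχ' p l)
  -- `hXuι`
  have hXuι := e.orbitEmbeddingOfHuuOfSection_map_GtpXu ιC hιC hinj op hodd s hsa hsZ hιell hN hY C hK hsH
      (epsPMInvχ_not_mem_range p) hι τ τ'
  -- decompose `y = inclX y₁ · inr z`
  obtain ⟨y₁, z, rfl⟩ : ∃ (y₁ : PiTpχ p) (z : Multiplicative (ZMod 2)),
      y = (inclInvχ p y₁ * SemidirectProduct.inr z : PiCInvχ p) :=
    ⟨y.left, y.right, (SemidirectProduct.inl_left_mul_inr_right y).symm⟩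
  have hleft : (inclInvχ p y₁ * SemidirectProduct.inr z : PiCInvχ p).left = y₁ := by simp [inclInvχ]
  have hright : (inclInvχ p y₁ * SemidirectProduct.inr z : PiCInvχ p).right = z := by simp [inclInvχ]
  -- `y₁ ∈ Π^tp_{X̲}` as soon as `inr z ∈ Π^tp_{C̲}` («`ι(Π^tp_X) ⊆ Π_X`» by `mem_range_hatInclX_iff`)
  have hy₁ : (SemidirectProduct.inr z : PiCInvχ p) ∈
      (e.temperedCoverDataOfHuuOfSection ιC hιC hinj op hodd s hsa hsZ hιell hN hY C hK hsH
        (epsPMInvχ_not_mem_range p) hι).tp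
      (e.temperedCoverDataOfHuuOfSection ιC hιC hinj op hodd s hsa hsZ hιell hN hY C hK hsH
        (epsPMInvχ_not_mem_range p) hι).PiCu → y₁ ∈ (MuTwoSetting.inversionModelχ' p).GtpXu l := fun hz =>
    (e.orbitEmbeddingOfHuuOfSection ιC hιC hinj op hodd s hsa hsZ hιell hN hY C hK hsH (epsPMInvχ_not_mem_range p)
      hι τ τ').mem_GtpXu_of_ι_mem_tp_PiCu hXuι
      (fun σ => (MuTwoSetting.CLevelData.mem_range_hatInclX_iff ιC hιC (e.piCDataOf ιC hιC).incl
        (e.piCDataOf_incl_toHat ιC hιC) _).2 ⟨σ, rfl⟩) (y₁ := y₁) ((Subgroup.mul_mem_cancel_right _ hz).1 hy)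
  -- `σ₀ := (φ_z y₁)⁻¹ ∈ Π^tp_{X̲}`
  have hkey : ∀ z : Multiplicative (ZMod 2), z = 1 ∨ z = Multiplicative.ofAdd 1 := by decide
  have hσ₀ : (invActionχ p z y₁)⁻¹ ∈ (MuTwoSetting.inversionModelχ' p).GtpXu l := by
    refine Subgroup.inv_mem _ ?_
    rcases hkey z with rfl | rfl
    · rw [map_one, MulAut.one_apply]
      exact hy₁ (by rw [map_one]; exact Subgroup.one_mem _)
    · rw [invActionχ_ofAdd_one]
      exact twistedInversion_mem_GtpXu_modelχ' p (hy₁ hεpm)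
  -- `σ₀ = h · w`, `h ∈ Π^tp_{X̲̲}`, `w ∈ Π^tp_Y` (stabiliser, §1)
  obtain ⟨h, hh, w, hw, hhw⟩ : ∃ h ∈ C.Huu, ∃ w ∈ (MuTwoSetting.inversionModelχ' p).toThetaSetting.GtpY,
      h * w = (invActionχ p z y₁)⁻¹ := by
    -- `Π^tp_{X̲} = Π^tp_{X̲̲}·Π^tp_Y`: pick `h ∈ Π^tp_{X̲̲}` of the same degree (`toZ(Π^tp_{X̲̲}) = l·Z`)
    have hdeg : (MuTwoSetting.inversionModelχ' p).toZ (invActionχ p z y₁)⁻¹ ∈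
        C.Huu.map (MuTwoSetting.inversionModelχ' p).toZ := by
      rw [C.map_toZ_Huu]; exact hσ₀
    obtain ⟨h, hh, hhz⟩ := hdeg
    refine ⟨h, hh, h⁻¹ * (invActionχ p z y₁)⁻¹, ?_, mul_inv_cancel_left _ _⟩
    change (MuTwoSetting.inversionModelχ' p).toZ _ = 1
    rw [map_mul, map_inv, hhz, inv_mul_cancel]
  have hconj_h : ContH1.conj (ThetaSetting.modelχ p).toTheta (ThetaSetting.modelχ p).DeltaTheta
        (invActionχ p z y₁)⁻¹ (etaDdχ p) =
      ContH1.conj (ThetaSetting.modelχ p).toTheta (ThetaSetting.modelχ p).DeltaTheta h (etaDdχ p) := by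
    rw [← hhw, ContH1.conj_mul_apply, conj_etaDdχ_eq_self_of_mem_GtpY p hw]
  -- parity: arrange `inclX σ ∈ Π^tp_Ċ` with the stabilising `b = ε_μ ∈ Π^tp_{X̲̲}` (§1, §2)
  have hbHuu : (SemidirectProduct.inl (gfpOf (FreeGroup.of 1)) : PiTpχ p) ∈ C.Huu := by
    rw [hC]; exact inl_gfpOf_of_one_mem_Huuχ p l
  obtain ⟨σ, hσHuu, hσdot, hσconj⟩ : ∃ σ ∈ C.Huu, (MuTwoSetting.inversionModelχ' p).inclX σ ∈
      (e.temperedCoverDataOfHuuOfSection ιC hιC hinj op hodd s hsa hsZ hιell hN hY C hK hsH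
        (epsPMInvχ_not_mem_range p) hι).PiCdot ∧
      ContH1.conj (ThetaSetting.modelχ p).toTheta (ThetaSetting.modelχ p).DeltaTheta h (etaDdχ p) =
        ContH1.conj (ThetaSetting.modelχ p).toTheta (ThetaSetting.modelχ p).DeltaTheta σ (etaDdχ p) := by
    by_cases hdot : (MuTwoSetting.inversionModelχ' p).inclX h ∈
        (e.temperedCoverDataOfHuuOfSection ιC hιC hinj op hodd s hsa hsZ hιell hN hY C hK hsH
          (epsPMInvχ_not_mem_range p) hι).PiCdot
    · exact ⟨h, hh, hdot, rfl⟩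
    · refine ⟨h * SemidirectProduct.inl (gfpOf (FreeGroup.of 1)), C.Huu.mul_mem hh hbHuu, ?_, ?_⟩
      · rw [hPiCdot] at hdot ⊢
        rw [map_mul]
        exact (MuTwoSetting.inversionModelχ' p).mul_epsMu_mem_dotC_of_not_mem hZ hdot
      · rw [ContH1.conj_mul_apply, conj_inl_b_etaDdχ p]
  refine ⟨σ, ⟨hσHuu, hσdot⟩, fun hΔ' hYα => ?_⟩
  -- model P-C5 (abc-iut-w6-d083): `σ₀ = (φ_z y₁)⁻¹`
  obtain ⟨σ₀, hσ₀eq, hP⟩ := exists_autMap_symm_etaDdχ_eq_conj p (ThetaSetting.modelχ p).compat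
    (inclInvχ p y₁ * SemidirectProduct.inr z) (e.conjX (inclInvχ p y₁ * SemidirectProduct.inr z)) _
    (fun g => e.inclX_conjX _ g)
    (e.orbitEmbeddingOfHuu_topCompanion_toTheta (isQuotientMap_toTheta_inversionModelχ' p) _) hΔ' hYα
  rw [hleft, hright] at hσ₀eq
  subst hσ₀eq
  rw [hE]
  exact hP.trans (hconj_h.trans hσconj)

/-! ## §4. The END-KNIT: Cor 2.8 (iii) clauses 3–4 at χ′ for every conjugator, own binders only -/

/-- **Cor 2.8 (iii), conjuncts 3–4 of `ThetaOrbitData.Cor28_iii` at `ofEmbedding (orbitEmbeddingOfHuuOfSection …)` over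
the cusped inversion model `χ′`, for EVERY conjugator `y ∈ Π^tp_C`** — "if `γ` arises from an inner automorphism of
`Π^tp_{Ċ̲̲}` (resp. `Π^tp_{Ċ̲}`), then `γ` preserves `η̲̈^{Θ,l·ℤ}` (resp. `η̈^{Θ,l·ℤ}`)": modulo Cor 2.8 (iii)'s OWN binders
(`Γ_Θ`+`InducesOnTheta`, `hY`, `hYuu`) ONLY — P-C5 (`σ₀`, `hη`) and `hq` discharged (§3), `Compat`/`Sec2Hyps` the χ′ theorems;
the constructor's binders as in p453395. [cite: MochizukiEtTh2009, Cor 2.8(iii) p.42] -/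
theorem cor28_iii_outer_endKnit_inversionModelχ'
    (y : (e.temperedCoverDataOfHuuOfSection ιC hιC hinj op hodd s hsa hsZ hιell hN hY C hK hsH
      (epsPMInvχ_not_mem_range p) hι).Gtp)
    (ΓΘ : (ThetaOrbitData.ofEmbedding
        (e.orbitEmbeddingOfHuuOfSection ιC hιC hinj op hodd s hsa hsZ hιell hN hY C hK hsH (epsPMInvχ_not_mem_range p) hι τ τ')
        (MuTwoSetting.inversionModelχ'_compat p) (ThetaSetting.modelχ'_sec2Hyps p)).DeltaTheta ≃*
      (ThetaOrbitData.ofEmbedding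
        (e.orbitEmbeddingOfHuuOfSection ιC hιC hinj op hodd s hsa hsZ hιell hN hY C hK hsH (epsPMInvχ_not_mem_range p) hι τ τ')
        (MuTwoSetting.inversionModelχ'_compat p) (ThetaSetting.modelχ'_sec2Hyps p)).DeltaTheta)
    (hind : (ThetaOrbitData.ofEmbedding
        (e.orbitEmbeddingOfHuuOfSection ιC hιC hinj op hodd s hsa hsZ hιell hN hY C hK hsH (epsPMInvχ_not_mem_range p) hι τ τ')
        (MuTwoSetting.inversionModelχ'_compat p) (ThetaSetting.modelχ'_sec2Hyps p)).InducesOnTheta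
      (ThetaOrbitData.innerAutTop y) ΓΘ)
    (hYmap : (e.temperedCoverDataOfHuuOfSection ιC hιC hinj op hodd s hsa hsZ hιell hN hY C hK hsH
          (epsPMInvχ_not_mem_range p) hι).PiYddtp.map (ThetaOrbitData.innerAutTop y).toMulEquiv.toMonoidHom =
      (e.temperedCoverDataOfHuuOfSection ιC hιC hinj op hodd s hsa hsZ hιell hN hY C hK hsH
        (epsPMInvχ_not_mem_range p) hι).PiYddtp)
    (hYuu : ((e.temperedCoverDataOfHuuOfSection ιC hιC hinj op hodd s hsa hsZ hιell hN hY C hK hsH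
            (epsPMInvχ_not_mem_range p) hι).PiYddtp ⊓
          (e.temperedCoverDataOfHuuOfSection ιC hιC hinj op hodd s hsa hsZ hιell hN hY C hK hsH
              (epsPMInvχ_not_mem_range p) hι).tp
            (e.temperedCoverDataOfHuuOfSection ιC hιC hinj op hodd s hsa hsZ hιell hN hY C hK hsH
              (epsPMInvχ_not_mem_range p) hι).PiXuu).map
        (ThetaOrbitData.innerAutTop y).toMulEquiv.toMonoidHom =
      (e.temperedCoverDataOfHuuOfSection ιC hιC hinj op hodd s hsa hsZ hιell hN hY C hK hsH
          (epsPMInvχ_not_mem_range p) hι).PiYddtp ⊓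
        (e.temperedCoverDataOfHuuOfSection ιC hιC hinj op hodd s hsa hsZ hιell hN hY C hK hsH
            (epsPMInvχ_not_mem_range p) hι).tp
          (e.temperedCoverDataOfHuuOfSection ιC hιC hinj op hodd s hsa hsZ hιell hN hY C hK hsH
            (epsPMInvχ_not_mem_range p) hι).PiXuu) :
    (y ∈ (e.temperedCoverDataOfHuuOfSection ιC hιC hinj op hodd s hsa hsZ hιell hN hY C hK hsH
            (epsPMInvχ_not_mem_range p) hι).tp
          (e.temperedCoverDataOfHuuOfSection ιC hιC hinj op hodd s hsa hsZ hιell hN hY C hK hsH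
            (epsPMInvχ_not_mem_range p) hι).PiCuu ⊓
        (e.temperedCoverDataOfHuuOfSection ιC hιC hinj op hodd s hsa hsZ hιell hN hY C hK hsH
          (epsPMInvχ_not_mem_range p) hι).PiCdot →
      (ThetaOrbitData.ofEmbedding
          (e.orbitEmbeddingOfHuuOfSection ιC hιC hinj op hodd s hsa hsZ hιell hN hY C hK hsH (epsPMInvχ_not_mem_range p)
            hι τ τ') (MuTwoSetting.inversionModelχ'_compat p) (ThetaSetting.modelχ'_sec2Hyps p)).transport _ _ hYuu ΓΘ
          (ThetaOrbitData.ofEmbedding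
            (e.orbitEmbeddingOfHuuOfSection ιC hιC hinj op hodd s hsa hsZ hιell hN hY C hK hsH (epsPMInvχ_not_mem_range p)
              hι τ τ') (MuTwoSetting.inversionModelχ'_compat p) (ThetaSetting.modelχ'_sec2Hyps p)).rootLZ =
        (ThetaOrbitData.ofEmbedding
          (e.orbitEmbeddingOfHuuOfSection ιC hιC hinj op hodd s hsa hsZ hιell hN hY C hK hsH (epsPMInvχ_not_mem_range p)
            hι τ τ') (MuTwoSetting.inversionModelχ'_compat p) (ThetaSetting.modelχ'_sec2Hyps p)).rootLZ) ∧
    (y ∈ (e.temperedCoverDataOfHuuOfSection ιC hιC hinj op hodd s hsa hsZ hιell hN hY C hK hsH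
            (epsPMInvχ_not_mem_range p) hι).tp
          (e.temperedCoverDataOfHuuOfSection ιC hιC hinj op hodd s hsa hsZ hιell hN hY C hK hsH
            (epsPMInvχ_not_mem_range p) hι).PiCu ⊓
        (e.temperedCoverDataOfHuuOfSection ιC hιC hinj op hodd s hsa hsZ hιell hN hY C hK hsH
          (epsPMInvχ_not_mem_range p) hι).PiCdot →
      (ThetaOrbitData.ofEmbedding
          (e.orbitEmbeddingOfHuuOfSection ιC hιC hinj op hodd s hsa hsZ hιell hN hY C hK hsH (epsPMInvχ_not_mem_range p)
            hι τ τ') (MuTwoSetting.inversionModelχ'_compat p) (ThetaSetting.modelχ'_sec2Hyps p)).transport _ _ hYmap ΓΘ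
          (ThetaOrbitData.ofEmbedding
            (e.orbitEmbeddingOfHuuOfSection ιC hιC hinj op hodd s hsa hsZ hιell hN hY C hK hsH (epsPMInvχ_not_mem_range p)
              hι τ τ') (MuTwoSetting.inversionModelχ'_compat p) (ThetaSetting.modelχ'_sec2Hyps p)).etaLZ =
        (ThetaOrbitData.ofEmbedding
          (e.orbitEmbeddingOfHuuOfSection ιC hιC hinj op hodd s hsa hsZ hιell hN hY C hK hsH (epsPMInvχ_not_mem_range p)
            hι τ τ') (MuTwoSetting.inversionModelχ'_compat p) (ThetaSetting.modelχ'_sec2Hyps p)).etaLZ) := by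
  refine ⟨fun hyuu => ?_, fun hyu => ?_⟩
  · obtain ⟨σ, hσ, hη⟩ := exists_mem_dotXuu_pC5_inversionModelχ' p e ιC hιC hinj op hodd s hsa hsZ hιell hN hY hE C hC
      hK hsH hι τ τ' y ((ThetaCovers.TemperedCoverData.tp_PiCuu_le_tp_PiCu _) (Subgroup.mem_inf.1 hyuu).1)
    exact (e.cor28_iii_outer_orbitEmbeddingOfHuuOfSection ιC hιC hinj op hodd s hsa hsZ hιell hN hY C hK hsH
      (epsPMInvχ_not_mem_range p) hι τ τ' (isQuotientMap_toTheta_inversionModelχ' p)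
      (MuTwoSetting.inversionModelχ'_compat p) (ThetaSetting.modelχ'_sec2Hyps p) y ΓΘ hind hYmap hYuu hσ hη).1 hyuu
  · obtain ⟨σ, hσ, hη⟩ := exists_mem_dotXuu_pC5_inversionModelχ' p e ιC hιC hinj op hodd s hsa hsZ hιell hN hY hE C hC
      hK hsH hι τ τ' y (Subgroup.mem_inf.1 hyu).1
    exact (e.cor28_iii_outer_orbitEmbeddingOfHuuOfSection ιC hιC hinj op hodd s hsa hsZ hιell hN hY C hK hsH
      (epsPMInvχ_not_mem_range p) hι τ τ' (isQuotientMap_toTheta_inversionModelχ' p)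
      (MuTwoSetting.inversionModelχ'_compat p) (ThetaSetting.modelχ'_sec2Hyps p) y ΓΘ hind hYmap hYuu hσ hη).2 hyu

end EndKnit

end SettingModel

end Literature.AnabelianGeometry.EtaleTheta

end
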